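import Literature.Computability.QuantumComplexity.OracleSubstitutionWeighted
import Literature.Computability.Cryptography.StatisticalDistanceISupMeasure
import HarnessLib

/-!
# Substituting subroutines for oracle gates: the output distribution, with the error on the ideal trajectory

Topic `Literature/Computability/QuantumComplexity`, sequel of `OracleSubstitutionWeighted.lean` (the
hybrid bound `OracleImpl.l2Norm_substGates_sub_le`: the substituted circuit differs from the ideal
oracle circuit, idle on the fresh wires, by at most the sum `trajErr` of the block errors along the
IDEAL trajectory) at the level of circuit FAMILIES and their classical output distributions
(`QCircuitFamily.kernel`), in the form the analysis of Regev's iterative step consumes (Regev 2009,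
Lemma 3.3: the quantum sampler of Lemma 3.14 with the `CVP` procedure of Lemma 3.4 plugged in):

* **`OracleImpl.abs_kernelProb_substFamily_sub_le_trajErr`** — for every event `E`,
  `|P_{F'}[output ∈ E] − P_F^A[y ++ 0^X ∈ E]| ≤ trajErr`, `F' = substFamily F B`, `X` the number of
  fresh wires (in the ideal run they stay `0`; close states have close statistics, BBBV Thm. 3.1 in
  the sharp one-event form `abs_sum_normSq_sub_le`);
* **`OracleImpl.tvDist_kernel_substFamily_le_trajErr`** — the same in total variation:
  `Δ(kernel of F' on x, (kernel of F^A on x).map (· ++ 0^X)) ≤ trajErr` (statistical distance is the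
  supremum over events, Goldreich 2001, §3.3.1 — the tree's `PMF.tvDist_eq_iSup_measure_holds`).

Everything is proved; no named fact is introduced.

## References

* C. H. Bennett, E. Bernstein, G. Brassard, U. Vazirani, *Strengths and weaknesses of quantum
  computing*, SIAM J. Comput. 26 (1997) 1510–1523, Thm. 3.1, Thm. 3.3 (proof), Cor. 4.15
  [BennettBernsteinBrassardVazirani1997].
* O. Goldreich, *Foundations of Cryptography* I, CUP 2001, §3.3.1 (statistical distance as a maximum
  over events) [Goldreich2001].
* O. Regev, *On lattices, learning with errors, random linear codes, and cryptography*, J. ACM 56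
  (2009), art. 34, Lemmas 3.3, 3.4, 3.14 [Regev2009].
-/

noncomputable section

namespace Literature.Computability.QuantumComplexity

open Cryptography Matrix

namespace OracleImpl

/-- **The output statistics of the substituted family, event by event**: for every event `E`,
`|P_{F'}[output ∈ E] − P_F^A[y ++ 0^X ∈ E]|` is at most the trajectory error of the substitution from
the padded input (`X = extra`, the fresh wires; `y` the measured output of `F` run WITH the oracle
`A`). [cite: BennettBernsteinBrassardVazirani1997, Cor. 4.15 with Thm. 3.1 and Thm. 3.3 (proof)] -/
theorem abs_kernelProb_substFamily_sub_le_trajErr (F : QCircuitFamily cliffordT) (B : ℕ → OracleImpl cliffordT)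
    (A : Language Bool) (x : List Bool) (E : Set (List Bool)) :
    |(substFamily F B).kernelProb 0 x E -
        F.kernelProb A x {y | y ++ List.replicate (extra (B x.length) (F.circ x.length).gates) false ∈ E}| ≤
      trajErr (B x.length) (N := x.length + F.ancillas x.length)
        (W := x.length + (F.ancillas x.length + extra (B x.length) (F.circ x.length).gates))
        (by omega) A 0 (x.length + F.ancillas x.length) (F.circ x.length).gates
        (basisState (padInput x.get (F.ancillas x.length + extra (B x.length) (F.circ x.length).gates))) := by
  classical
  -- notation
  set n := x.length with hn
  set m := F.ancillas n with hm
  set X := extra (B n) (F.circ n).gates with hX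
  have hNW : n + m ≤ n + (m + X) := by omega
  set V := (F.circ n).toMatrix A with hV
  set w : QReg (n + (m + X)) := padInput x.get (m + X) with hw
  have hwN : ∀ i : Fin (n + (m + X)), n + m ≤ (i : ℕ) → w i = false := fun i hi =>
    padInput_apply_of_le _ _ (by omega)
  -- the substituted circuit, as a matrix on the ambient register
  set S : Matrix (QReg (n + (m + X))) (QReg (n + (m + X))) ℂ := ((substFamily F B).circ n).toMatrix 0 with hS
  have hSU : S ∈ Matrix.unitaryGroup (QReg (n + (m + X))) ℂ :=
    QCircuit.toMatrix_mem_unitaryGroup_holds cliffordT_isUnitary_holds 0 _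
  -- the substituted family's kernel as a Born sum
  have hK : (substFamily F B).kernelProb 0 x E = ∑ z : QReg (n + (m + X)),
      if List.ofFn z ∈ E then ‖(S *ᵥ basisState w) z‖ ^ 2 else 0 := by
    change (((((substFamily F B).circ n).outputPMF 0 x.get).map List.ofFn).toOuterMeasure E).toReal = _
    rw [toReal_outputPMF_map_ofFn]
    rfl
  -- the original family's kernel as a Born sum
  have hF : F.kernelProb A x {y | y ++ List.replicate X false ∈ E} = ∑ u : QReg (n + m),
      if List.ofFn u ++ List.replicate X false ∈ E then ‖V u (padInput x.get m)‖ ^ 2 else 0 := by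
    change ((((F.circ n).outputPMF A x.get).map List.ofFn).toOuterMeasure
      {y | y ++ List.replicate X false ∈ E}).toReal = _
    rw [toReal_outputPMF_map_ofFn]
    refine Finset.sum_congr rfl fun u _ => ?_
    rw [QCircuit.runOn, mulVec_basisState]
    rfl
  -- the ideal run: the original circuit on the first `n + m` wires, fresh wires idle
  have hideal : (∑ z : QReg (n + (m + X)), if List.ofFn z ∈ E then
      ‖(placeGate (Fin.castLEEmb hNW) V *ᵥ basisState w) z‖ ^ 2 else 0) =
      F.kernelProb A x {y | y ++ List.replicate X false ∈ E} := by
    rw [hF]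
    have hXW : n + (m + X) - (n + m) = X := by omega
    have hterm : ∀ z : QReg (n + (m + X)),
        (if List.ofFn z ∈ E then ‖(placeGate (Fin.castLEEmb hNW) V *ᵥ basisState w) z‖ ^ 2 else 0) =
          if List.ofFn (z ∘ Fin.castLEEmb hNW) ++ List.replicate X false ∈ E then
            ‖(placeGate (Fin.castLEEmb hNW) V *ᵥ basisState w) z‖ ^ 2 else 0 := by
      intro z
      by_cases hz : ∀ i : Fin (n + (m + X)), n + m ≤ (i : ℕ) → z i = false
      · rw [ofFn_eq_append_replicate hNW z hz, hXW]
        rfl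
      · have h0 : (placeGate (Fin.castLEEmb hNW) V *ᵥ basisState w) z = 0 := by
          rw [placeGate_castLE_mulVec_basisState hNW V w hwN z, if_neg hz]
        simp [h0]
    simp_rw [hterm]
    rw [sum_normSq_placeGate_castLE hNW V w (fun u : QReg (n + m) => List.ofFn u ++ List.replicate X false ∈ E)]
    refine Finset.sum_congr rfl fun u _ => ?_
    rw [show w ∘ Fin.castLEEmb hNW = padInput x.get m from padInput_comp_castLE x.get hNW]
  -- the substituted run is close to the ideal run, on the ideal trajectory
  have htraj := l2Norm_substGates_sub_le cliffordT_isUnitary_holds (B n) hNW A 0 (F.circ n).gates (n + m) le_rfl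
    (by omega) (basisState w) (suppIn_basisState fun i hi => hwN i hi)
  -- unit vectors
  have hunitS : normSq (S *ᵥ basisState w) = 1 := by
    rw [normSq_mulVec_of_mem_unitaryGroup hSU, normSq_basisState]
  have hunitI : normSq (placeGate (Fin.castLEEmb hNW) V *ᵥ basisState w) = 1 := by
    rw [normSq_mulVec_of_mem_unitaryGroup (placeGate_mem_unitaryGroup_holds _
      (QCircuit.toMatrix_mem_unitaryGroup_holds cliffordT_isUnitary_holds A _)), normSq_basisState]
  have hstat : |(∑ z : QReg (n + (m + X)), if List.ofFn z ∈ E then ‖(S *ᵥ basisState w) z‖ ^ 2 else 0) -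
      ∑ z : QReg (n + (m + X)), if List.ofFn z ∈ E then ‖(placeGate (Fin.castLEEmb hNW) V *ᵥ basisState w) z‖ ^ 2 else 0| ≤
      l2Norm (S *ᵥ basisState w - placeGate (Fin.castLEEmb hNW) V *ᵥ basisState w) := by
    simpa only [Finset.sum_filter] using
      abs_sum_normSq_sub_le hunitS hunitI (Finset.univ.filter fun z => List.ofFn z ∈ E)
  show |(substFamily F B).kernelProb 0 x E - F.kernelProb A x {y | y ++ List.replicate X false ∈ E}| ≤
    trajErr (B n) hNW A 0 (n + m) (F.circ n).gates (basisState w)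
  rw [hK, ← hideal]
  exact hstat.trans htraj

/-- **The output distribution of the substituted family in total variation**:
`Δ(kernel of F' on x, (kernel of F^A on x) pushed forward by y ↦ y ++ 0^X) ≤ trajErr` — the error of
the substitution along the ideal trajectory from the padded input.
[cite: BennettBernsteinBrassardVazirani1997, Cor. 4.15 with Thm. 3.1] [cite: Goldreich2001, §3.3.1] -/
theorem tvDist_kernel_substFamily_le_trajErr (F : QCircuitFamily cliffordT) (B : ℕ → OracleImpl cliffordT)
    (A : Language Bool) (x : List Bool) :
    ((substFamily F B).kernel 0 x).tvDist
        ((F.kernel A x).map fun y => y ++ List.replicate (extra (B x.length) (F.circ x.length).gates) false) ≤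
      trajErr (B x.length) (N := x.length + F.ancillas x.length)
        (W := x.length + (F.ancillas x.length + extra (B x.length) (F.circ x.length).gates))
        (by omega) A 0 (x.length + F.ancillas x.length) (F.circ x.length).gates
        (basisState (padInput x.get (F.ancillas x.length + extra (B x.length) (F.circ x.length).gates))) := by
  rw [PMF.tvDist_eq_iSup_measure_holds]
  refine ciSup_le fun S => ?_
  rw [PMF.toOuterMeasure_map_apply]
  have h := abs_kernelProb_substFamily_sub_le_trajErr F B A x S
  unfold QCircuitFamily.kernelProb at h
  exact (le_abs_self _).trans h

end OracleImpl

end Literature.Computability.QuantumComplexity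

end
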